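import Summits.FinalStateConjecture.FinalStateConjecture.Theorems.BartnikGapSettlingBondiBartnikRigidityExactChartGluing
import Literature.Geometry.Lorentzian.MaxAtlasChartKilling
import Literature.Geometry.Lorentzian.ExtChartKillingTransfer
import Literature.Geometry.Lorentzian.MultiCentreKerrSchild
import Literature.Geometry.Manifold.InjOnLocalDiffeomorphInverse
import HarnessLib

/-!
# Brick G3 `ExactStarChartKilling` for `stub_killingPropagation'` (K1a β′) — line
# `direct-method-on-the-cone` (crux `BondiBartnikRigidity`, stmt-FinalStateConjecture-10807)

**An exact chart of the boosted Kerr star background pushes the frame time translation `Λe₀`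
forward to a Killing field of the spacetime metric on its image.**  Let `B = starBackground Λ c
M a (r_a ∘ (Λ, c)⁻¹)` be the collar background, `O ⊆ B.domain` open, and `Ψ : B.domain → 𝒮` smooth
on `O`, an open embedding of `O`, and EXACT OF ORDER `0` on `O` (`supCkENorm (val '' O) 0
(deviationExtend B Ψ) ≤ 0`).  Then there is a section `ζ` of `T𝒮` which is a Killing field of
`g = 𝒮.metric` on the open set `Ψ '' O` (`IsKillingFieldOn`: smooth on `Ψ '' O`, Killing equation
at its points) with `ζ (Ψ x) = dΨ_x (Λ e₀)` for `x ∈ O` (registered stub `stub_exactStarChartKilling`,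
consumed verbatim by the β′ assembly `stub_killingPropagation'_of_facts`).

Proof (O'Neill 1983, Ch. 9, Prop. 9.25 with Ch. 3, Prop. 3.59; Kerr–Schild 1965, §2).
(1) Order-`0` exactness is the pointwise isometry condition `g(dΨ v, dΨ w) = g_B(v, w)` on `O`
(`K2Route.metric_mfderiv_eq_bilin_of_supCkENorm_le_zero`); `g_B = boostedKerrBilin Λ c M a` is
nondegenerate on `B.domain`, so `dΨ_x` is injective, hence bijective (`E4 → E4`).  (2) `Ψ` is
injective on the open set `O` with bijective differential, so `invFunOn Ψ O` is smooth on the open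
image `Ψ '' O` (inverse function theorem, `contMDiffOn_invFunOn_of_bijective_mfderiv`), and
`ψ = val ∘ (Ψ|_O)⁻¹ : Ψ '' O → val '' O ⊆ E4` is a chart of the MAXIMAL atlas of `𝒮`
(`IsManifold.mem_maximalAtlas_iff_contMDiffOn`) whose inverse is `Ψ`.  (3) The metric transported
to the chart target, `Ψ^* g` (`MaxAtlasChart.metric`), has components `boostedKerrBilin Λ c M a` by
(1); these are stationary along `Λe₀` (`KerrSchildChart.boostedKerrBilin_add_smul`: `g_B(x + sΛe₀) =
g_B(x)`), so `∂_{Λe₀} g_B = 0` and the CONSTANT field `Λe₀` satisfies the coordinate Killing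
equation `DG(W)(a,b) + G(DW a, b) + G(a, DW b) = 0` (`ExtChartKilling.val_leviCivita_add_eq_coord`).
(4) The constant field is `Ψ^* ζ` for a section `ζ` of `T𝒮` smooth on `Ψ '' O`
(`MaxAtlasChart.exists_contMDiffOn_source_mpullback_inv_eq`), the Killing equation transports back
to `𝒮` along the local isometry `Ψ` (`MaxAtlasChart.killingOn_source_of_mpullback_inv`), and
`ζ (Ψ x) = dΨ_x (Ψ^* ζ)(x) = dΨ_x (Λe₀)` (`MaxAtlasChart.apply_inv_eq_mfderiv_mpullback`).

References: O'Neill 1983, Ch. 3, Prop. 3.59, Ch. 9, Prop. 9.25 [ONeill1983]; Kerr–Schild 1965, §2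
(stationarity and Lorentz covariance of the Kerr–Schild form) [KerrSchild1965]; Lee 2013, Thm. 4.5
(inverse function theorem) [LeeSmoothManifolds2013].  No definitions, no named facts.
-/

noncomputable section

-- D-0017: single-problem summit, `Summit.<S>.<S>.…` by design (cf. lakefile `weak.linter.dupNamespace`).
set_option linter.dupNamespace false
-- instance search through the nested operator types of the Kerr chart facts
set_option maxSynthPendingDepth 3

open Set Filter Function Topology TopologicalSpace Bundle VectorField
open Literature.Geometry.Lorentzian
open scoped Manifold ContDiff Topology ENNReal

namespace Summit.FinalStateConjecture.FinalStateConjecture.Theorems.BondiBartnikRigidity.DirectMethod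

namespace K1aRoute

/-- **`∂_{Λe₀} g_B = 0` for the boosted Kerr–Schild form**: the derivative of
`boostedKerrBilin Λ c M a` in the direction of the frame time translation `Λe₀` vanishes wherever
the components are differentiable (the line `s ↦ x + sΛe₀` is mapped to a constant,
`KerrSchildChart.boostedKerrBilin_add_smul`). Kerr–Schild 1965, §2 (stationarity of the
Kerr–Schild components, transported by the Poincaré map). [cite: KerrSchild1965, §2] -/
theorem fderiv_boostedKerrBilin_frameTime (Λ : lorentzGroup) (c : E4) (M a : ℝ) {z : E4}
    (hz : DifferentiableAt ℝ (boostedKerrBilin Λ c M a) z) :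
    fderiv ℝ (boostedKerrBilin Λ c M a) z ((Λ : E4 ≃L[ℝ] E4) (E4.basisVector 0)) = 0 := by
  have h1 : HasLineDerivAt ℝ (boostedKerrBilin Λ c M a)
      (fderiv ℝ (boostedKerrBilin Λ c M a) z ((Λ : E4 ≃L[ℝ] E4) (E4.basisVector 0))) z
      ((Λ : E4 ≃L[ℝ] E4) (E4.basisVector 0)) :=
    hz.hasFDerivAt.hasLineDerivAt _
  have h2 : HasLineDerivAt ℝ (boostedKerrBilin Λ c M a) 0 z
      ((Λ : E4 ≃L[ℝ] E4) (E4.basisVector 0)) := by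
    have : (fun t : ℝ ↦ boostedKerrBilin Λ c M a (z + t • (Λ : E4 ≃L[ℝ] E4) (E4.basisVector 0))) =
        fun _ ↦ boostedKerrBilin Λ c M a z :=
      funext fun t ↦ KerrSchildChart.boostedKerrBilin_add_smul Λ c M a z t
    show HasDerivAt
      (fun t : ℝ ↦ boostedKerrBilin Λ c M a (z + t • (Λ : E4 ≃L[ℝ] E4) (E4.basisVector 0))) 0 0
    rw [this]
    exact hasDerivAt_const (0 : ℝ) _
  exact h1.unique h2

end K1aRoute

open K1aRoute in
/-- **Registered stub `stub_exactStarChartKilling` (brick G3 of `stub_killingPropagation'`, K1a β′)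
of the line `direct-method-on-the-cone`**: an exact chart `Ψ` (smooth open embedding of an open
`O ⊆ B.domain`, order-`0` deviation `0`) of the boosted Kerr STAR background
`B = starBackground Λ c M a (r_a ∘ (Λ, c)⁻¹)` into a spacetime `𝒮` pushes the frame time
translation `Λe₀` forward to a Killing field `ζ` of `𝒮.metric` on the image `Ψ '' O`, with
`ζ (Ψ x) = dΨ_x(Λe₀)` on `O`.  Isometries carry Killing fields to Killing fields (O'Neill 1983,
Ch. 9, Prop. 9.25 with Ch. 3, Prop. 3.59), applied to the local isometry `Ψ|_O` — a chart of the
maximal atlas of `𝒮` by the inverse function theorem — and the stationarity `∂_{Λe₀} g_B = 0` of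
the boosted Kerr–Schild form (Kerr–Schild 1965, §2). [cite: ONeill1983, Ch. 9, Prop. 9.25] -/
theorem stub_exactStarChartKilling : ∀ (𝒮 : Spacetime.{0} 4) [𝒮.metric.toPseudoRiemannianMetric.HasLeviCivita] (M a : ℝ), 0 < M → |a| < M → ∀ (mo : lorentzGroup × E4) (B : ModelBackground), B = starBackground mo.1 mo.2 M a (fun x => Kerr.radius a (poincareInv mo.1 mo.2 x)) → ∀ (O : Set B.domain) (Ψ : B.domain → 𝒮.carrier), IsOpen O → ContMDiffOn 𝓘(ℝ, E4) (𝓡 4) ∞ Ψ O → IsOpenEmbedding (O.restrict Ψ) → supCkENorm (Subtype.val '' O) 0 (𝒮.deviationExtend B Ψ) ≤ 0 → ∃ ζ : Π y : 𝒮.carrier, TangentSpace (𝓡 4) y, 𝒮.metric.IsKillingFieldOn ζ (Ψ '' O) ∧ ∀ x ∈ O, ζ (Ψ x) = mfderiv 𝓘(ℝ, E4) (𝓡 4) Ψ x ((mo.1 : E4 ≃L[ℝ] E4) (E4.basisVector 0)) := by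
  intro 𝒮 _ M a _ _ mo B hB O Ψ hO hs he hd
  classical
  -- the empty chart: nothing to prove
  rcases O.eq_empty_or_nonempty with hOe | hOne
  · subst hOe
    refine ⟨fun _ ↦ 0, ?_, fun x hx ↦ hx.elim⟩
    rw [image_empty]
    exact ⟨fun _ h ↦ h.elim, fun _ h ↦ h.elim⟩
  obtain ⟨x₀, -⟩ := hOne
  haveI : Nonempty B.domain := ⟨x₀⟩
  -- notation: the metric, the frame time translation, the background components
  set g : PseudoRiemannianMetric 𝓘(ℝ, E4) ∞ E4 (TangentSpace 𝓘(ℝ, E4) : 𝒮.carrier → Type _) :=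
    𝒮.metric.toPseudoRiemannianMetric
  set v₀ : E4 := (mo.1 : E4 ≃L[ℝ] E4) (E4.basisVector 0)
  set G : E4 → E4 →L[ℝ] E4 →L[ℝ] ℝ := boostedKerrBilin mo.1 mo.2 M a with hGdef
  have hbil : B.bilin = G := by rw [hB]; rfl
  have hdom : ∀ z : E4, z ∈ B.domain ↔ poincareInv mo.1 mo.2 z ∈ Kerr.region a M := fun z ↦ by
    rw [hB]; rfl
  -- (1) order-0 exactness: `Ψ^* g = g_B` pointwise on `O`
  have hiso : ∀ x ∈ O, ∀ v w : E4, 𝒮.metric.val (Ψ x) (mfderiv 𝓘(ℝ, E4) (𝓡 4) Ψ x v)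
      (mfderiv 𝓘(ℝ, E4) (𝓡 4) Ψ x w) = G x.1 v w := fun x hx v w ↦ by
    rw [K2Route.metric_mfderiv_eq_bilin_of_supCkENorm_le_zero hd hx v w, hbil]
  -- nondegeneracy of the boosted Kerr–Schild form on the domain
  have hnd : ∀ (x : B.domain) (v : E4), (∀ w, G x.1 v w = 0) → v = 0 := fun x v hv ↦ by
    have key : ∀ w' : E4,
        Kerr.bilin M a (poincareInv mo.1 mo.2 x.1) ((mo.1 : E4 ≃L[ℝ] E4).symm v) w' = 0 := by
      intro w'
      have h := hv ((mo.1 : E4 ≃L[ℝ] E4) w')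
      rw [hGdef, boostedKerrBilin_apply, ContinuousLinearEquiv.symm_apply_apply] at h
      exact h
    have hsu : (mo.1 : E4 ≃L[ℝ] E4).symm v = 0 :=
      Kerr.bilin_nondegenerate M a (Kerr.radius_pos_of_mem_region ((hdom x.1).1 x.2)) _ key
    simpa using congrArg (mo.1 : E4 ≃L[ℝ] E4) hsu
  -- `Ψ` is injective on `O` with bijective differential
  have hinj : InjOn Ψ O := injOn_iff_injective.2 he.injective
  have hbij : ∀ x ∈ O, Bijective (mfderiv 𝓘(ℝ, E4) (𝓡 4) Ψ x) := fun x hx ↦ by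
    have hinjL : ∀ v v' : E4, mfderiv 𝓘(ℝ, E4) (𝓡 4) Ψ x v = mfderiv 𝓘(ℝ, E4) (𝓡 4) Ψ x v' →
        v = v' := fun v v' hvv' ↦ by
      have h1 : v - v' = 0 := hnd x (v - v') fun w ↦ by
        rw [map_sub, sub_apply, ← hiso x hx v w, ← hiso x hx v' w, hvv', sub_self]
      exact sub_eq_zero.1 h1
    haveI : FiniteDimensional ℝ (TangentSpace 𝓘(ℝ, E4) x) :=
      inferInstanceAs (FiniteDimensional ℝ E4)
    have hsurjL : Surjective (mfderiv 𝓘(ℝ, E4) (𝓡 4) Ψ x) :=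
      (LinearMap.injective_iff_surjective
        (f := (mfderiv 𝓘(ℝ, E4) (𝓡 4) Ψ x).toLinearMap)).1 fun v v' h ↦ hinjL v v' h
    exact ⟨fun v v' h ↦ hinjL v v' h, hsurjL⟩
  -- (2) the inverse of `Ψ|_O` is smooth on the open image (inverse function theorem)
  have hinv : ContMDiffOn (𝓡 4) 𝓘(ℝ, E4) ∞ (invFunOn Ψ O) (Ψ '' O) :=
    Literature.Geometry.Manifold.contMDiffOn_invFunOn_of_bijective_mfderiv hO hs hinj hbij
  -- the retraction `E4 → B.domain` (junk `x₀` off the domain, never used)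
  let proj : E4 → B.domain := fun z ↦ if hz : z ∈ B.domain then ⟨z, hz⟩ else x₀
  have hproj : ∀ x : B.domain, proj x.1 = x := fun x ↦ by
    show (if hz : (x : E4) ∈ B.domain then (⟨x, hz⟩ : B.domain) else x₀) = x
    rw [dif_pos x.2]
  have hΨproj : (fun y : B.domain ↦ Ψ (proj y)) = Ψ := funext fun y ↦ by rw [hproj]
  -- both pieces of the chart are smooth on open sets
  have hsrc : IsOpen (Ψ '' O) := by rw [← range_restrict]; exact he.isOpen_range
  have htgt : IsOpen (Subtype.val '' O : Set E4) := B.domain.isOpen.isOpenMap_subtype_val O hO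
  have h1 : ContMDiffOn (𝓡 4) 𝓘(ℝ, E4) ∞ (fun y ↦ (invFunOn Ψ O y).1) (Ψ '' O) :=
    contMDiff_subtype_val.comp_contMDiffOn hinv
  have h2 : ContMDiffOn 𝓘(ℝ, E4) (𝓡 4) ∞ (fun z ↦ Ψ (proj z)) (Subtype.val '' O) := by
    rintro _ ⟨x, hx, rfl⟩
    refine ContMDiffAt.contMDiffWithinAt ?_
    have hx' : ContMDiffAt 𝓘(ℝ, E4) (𝓡 4) ∞ (fun y : B.domain ↦ Ψ (proj y)) x := by
      rw [hΨproj]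
      exact (hs x hx).contMDiffAt (hO.mem_nhds hx)
    exact (contMDiffAt_subtype_iff (U := B.domain) (f := fun z ↦ Ψ (proj z))).1 hx'
  -- the chart `ψ = val ∘ (Ψ|_O)⁻¹` of `𝒮` with inverse `Ψ`
  have hms : ∀ ⦃y⦄, y ∈ Ψ '' O → (invFunOn Ψ O y).1 ∈ Subtype.val '' O := fun y hy ↦
    mem_image_of_mem Subtype.val (Literature.Geometry.Manifold.invFunOn_mem hy)
  have hmt : ∀ ⦃z⦄, z ∈ Subtype.val '' O → Ψ (proj z) ∈ Ψ '' O := by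
    rintro _ ⟨x, hx, rfl⟩
    rw [hproj]
    exact mem_image_of_mem Ψ hx
  have hli : ∀ ⦃y⦄, y ∈ Ψ '' O → Ψ (proj (invFunOn Ψ O y).1) = y := fun y hy ↦ by
    rw [hproj]
    exact Literature.Geometry.Manifold.apply_invFunOn hy
  have hri : ∀ ⦃z⦄, z ∈ Subtype.val '' O → (invFunOn Ψ O (Ψ (proj z))).1 = z := by
    rintro _ ⟨x, hx, rfl⟩
    rw [hproj, Literature.Geometry.Manifold.invFunOn_apply hinj hx]
  obtain ⟨ψ, hψs, hψt, hψa, hψi⟩ : ∃ ψ : OpenPartialHomeomorph 𝒮.carrier E4,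
      ψ.source = Ψ '' O ∧ ψ.target = Subtype.val '' O ∧
        (∀ y, ψ y = (invFunOn Ψ O y).1) ∧ ∀ z, ψ.symm z = Ψ (proj z) :=
    ⟨{ toFun := fun y ↦ (invFunOn Ψ O y).1, invFun := fun z ↦ Ψ (proj z), source := Ψ '' O,
        target := Subtype.val '' O, map_source' := hms, map_target' := hmt, left_inv' := hli,
        right_inv' := hri, open_source := hsrc, open_target := htgt,
        continuousOn_toFun := h1.continuousOn, continuousOn_invFun := h2.continuousOn },
      rfl, rfl, fun _ ↦ rfl, fun _ ↦ rfl⟩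
  have hψ : ψ ∈ IsManifold.maximalAtlas 𝓘(ℝ, E4) ∞ 𝒮.carrier := by
    refine (IsManifold.mem_maximalAtlas_iff_contMDiffOn ψ).2 ⟨?_, ?_⟩
    · rw [hψs]
      exact h1.congr fun y _ ↦ hψa y
    · rw [hψt]
      exact h2.congr fun z _ ↦ hψi z
  -- points of the chart target come from `O`
  have htp : ∀ p : MaxAtlasChart.target ψ, ∃ x ∈ O, (x : E4) = p := fun p ↦ by
    have hp : (p : E4) ∈ ψ.target := p.2
    rw [hψt] at hp
    obtain ⟨x, hx, h⟩ := hp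
    exact ⟨x, hx, h⟩
  have hmemt : ∀ {x : B.domain}, x ∈ O → (x : E4) ∈ MaxAtlasChart.target ψ := fun {x} hx ↦ by
    show (x : E4) ∈ ψ.target
    rw [hψt]
    exact mem_image_of_mem Subtype.val hx
  -- the inverse chart is `Ψ`, with differential `dΨ`
  have hinvψ : ∀ {x : B.domain} (hx : x ∈ O), MaxAtlasChart.inv ψ ⟨x, hmemt hx⟩ = Ψ x :=
    fun {x} hx ↦ by rw [MaxAtlasChart.inv_apply, hψi, hproj]
  have hdinv : ∀ {x : B.domain} (hx : x ∈ O),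
      mfderiv 𝓘(ℝ, E4) 𝓘(ℝ, E4) (MaxAtlasChart.inv ψ) ⟨x, hmemt hx⟩ =
        mfderiv 𝓘(ℝ, E4) (𝓡 4) Ψ x := fun {x} hx ↦ by
    rw [MaxAtlasChart.mfderiv_inv hψ]
    have hsd : MDifferentiableAt 𝓘(ℝ, E4) 𝓘(ℝ, E4) ψ.symm (x : E4) :=
      (MaxAtlasChart.mdifferentiable_chart hψ).symm.mdifferentiableAt (hmemt hx)
    have hfun : (ψ.symm ∘ Subtype.val : B.domain → 𝒮.carrier) = Ψ := by
      rw [← hΨproj]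
      funext y
      exact hψi y
    have h := mfderiv_comp_subtypeVal (W := B.domain) (I := 𝓘(ℝ, E4)) hsd
    rw [hfun] at h
    exact h.symm
  -- (3) the transported metric `Ψ^* g` on the chart target has components `g_B`
  haveI := (MaxAtlasChart.metric g hψ).hasLeviCivita
  have hG : ∀ p : MaxAtlasChart.target ψ, (MaxAtlasChart.metric g hψ).val p = G p := fun p ↦ by
    obtain ⟨x, hx, hxp⟩ := htp p
    obtain rfl : p = ⟨x, hmemt hx⟩ := Subtype.ext hxp.symm
    ext a b
    rw [MaxAtlasChart.metric_val, hdinv hx]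
    have hsx : ψ.symm (x : E4) = Ψ x := by rw [hψi, hproj]
    rw [hsx]
    exact hiso x hx a b
  have hGd : ∀ p : MaxAtlasChart.target ψ, DifferentiableAt ℝ G p := fun p ↦ by
    obtain ⟨x, hx, hxp⟩ := htp p
    have hr : 0 < Kerr.radius a (poincareInv mo.1 mo.2 (p : E4)) := by
      rw [← hxp]
      exact Kerr.radius_pos_of_mem_region ((hdom x.1).1 x.2)
    exact (contDiffAt_boostedKerrBilin mo.1 mo.2 M a hr (n := 1)).differentiableAt one_ne_zero
  -- the constant field `Λe₀` on the chart target satisfies the Killing equation of `Ψ^* g`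
  let Y : Π p : MaxAtlasChart.target ψ, TangentSpace 𝓘(ℝ, E4) p := fun _ ↦ v₀
  have hY : ContMDiff 𝓘(ℝ, E4) (𝓘(ℝ, E4).prod 𝓘(ℝ, E4)) ∞
      (fun p ↦ (TotalSpace.mk' E4 p (Y p) : TangentBundle 𝓘(ℝ, E4) (MaxAtlasChart.target ψ))) :=
    fun p ↦ (OpensChart.contMDiffAt_section_iff p Y).2 contMDiffAt_const
  have hKY : ∀ (p : MaxAtlasChart.target ψ) (Y₀ Z₀ : E4),
      (MaxAtlasChart.metric g hψ).val p ((MaxAtlasChart.metric g hψ).leviCivita Y p Y₀) Z₀ +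
        (MaxAtlasChart.metric g hψ).val p Y₀
          ((MaxAtlasChart.metric g hψ).leviCivita Y p Z₀) = 0 := fun p Y₀ Z₀ ↦ by
    rw [ExtChartKilling.val_leviCivita_add_eq_coord hG p (hGd p) (W := Y) (Wf := fun _ ↦ v₀)
      (fun _ ↦ rfl) (differentiableAt_const v₀) Y₀ Z₀]
    simp only [fderiv_fun_const, Pi.zero_apply, zero_apply, map_zero, add_zero]
    rw [fderiv_boostedKerrBilin_frameTime mo.1 mo.2 M a (hGd p)]
    rfl
  -- (4) transport back to `𝒮` along the local isometry `Ψ`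
  obtain ⟨ζ, hζs, hζY⟩ := MaxAtlasChart.exists_contMDiffOn_source_mpullback_inv_eq hψ Y hY
  have hfunY : mpullback 𝓘(ℝ, E4) 𝓘(ℝ, E4) (MaxAtlasChart.inv ψ) ζ = Y := funext hζY
  refine ⟨ζ, ⟨?_, ?_⟩, fun x hx ↦ ?_⟩
  · rw [← hψs]
    exact hζs
  · rw [← hψs]
    exact MaxAtlasChart.killingOn_source_of_mpullback_inv g hψ hζs fun p Y₀ Z₀ ↦ by
      rw [hfunY]
      exact hKY p Y₀ Z₀
  · have h := MaxAtlasChart.apply_inv_eq_mfderiv_mpullback hψ ζ ⟨x, hmemt hx⟩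
    rw [hζY, hdinv hx, hinvψ hx] at h
    exact h

end Summit.FinalStateConjecture.FinalStateConjecture.Theorems.BondiBartnikRigidity.DirectMethod

end
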